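import Summits.ValiantsHypothesis.ValiantsHypothesis.Theorems.GrenetZeonZeonPoint
import Literature.Computability.AlgebraicComplexity.AlgDetRepr
import Literature.Computability.AlgebraicComplexity.QPBoundedClosure
import HarnessLib

/-!
# Crux `GrenetZeon.AbelianizationQP` (stmt-ValiantsHypothesis-8063), line `zeon-window` —
THE WINDOW STUB IS THE CRUX, and the crux is automatic above an exponential lower bound

The crux `AbelianizationQP`: `∃ c`, every affine determinantal representation of `per_n` (`n ≥ 1`)
of size `m` yields an `(n^c + c, 2^((log₂ m + c)^c))`-representation (`HasAlgDetRepr`, inlined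
verbatim by the route statement).  The registered skeleton `Lines/zeon_window.lean` splits it along
the zeon threshold `n ≤ (log₂ m + c)^c` into `stub_zeonPoint` (the zeon point `(n, 2^n)`, landed
separately as `Theorems/GrenetZeonAbelianizationQPStubZeonPoint.lean`) and the window stub
`stub_subexpAbelianization` (`∃ c ≥ 1`, abelianization for `(log₂ m + c)^c < n`).

Settled here (bookkeeping, unconditional):

* `subexpAbelianization_of_abelianizationQP` / `abelianizationQP_of_subexpAbelianization` /
  `abelianizationQP_iff_subexpAbelianization` — **the window stub is EQUIVALENT to the crux**
  (forward: bump the constant to `c + 1 ≥ 1` by monotonicity; backward: the skeleton's case split,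
  with the proved zeon point `zeonPoint_proof` above the threshold).  Diagnosis for the line: the
  decomposition isolates no easier statement — its one open stub carries the crux whole
  (open-problem grade, as filed: "abelianization is known only for Boolean-lattice (Grenet) and
  exterior-algebra (Landsberg–Ressayre) representations").
* `abelianizationQP_of_expLowerBound` — **an exponential lower bound makes the crux automatic**: if
  for some `c` every affine determinantal representation of `per_n` (`n ≥ 1`) of size `m` has
  `n ≤ (log₂ m + c)^c` (i.e. `dc(per_n) ≥ 2^{n^{1/c}}`-type growth), then `AbelianizationQP` holds —
  the zeon point `(n, 2^n)` padded to `(n^c + c, 2^((log₂ m + c)^c))` serves every `m`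
  (`HasAlgDetRepr.mono`); `abelianizationQP_of_expLowerBound_dc` is the same with the hypothesis on
  `dc(per_n)`.  Hence also `subexpAbelianization_of_expLowerBound` (the window is empty).

Honest framing: no abelianization of any representation is performed here; the content of the crux
(the window `n²/2 ≤ m < 2^{n^{1/c}}`) is untouched and open.  Nothing here is progress on VP ≠ VNP.
Axioms `propext`, `Classical.choice`, `Quot.sound`.
-/

set_option linter.dupNamespace false

noncomputable section

namespace Summit.ValiantsHypothesis.ValiantsHypothesis.Theorems.GrenetZeonAbelianizationQP

open Literature.Computability.AlgebraicComplexity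
open Summit.ValiantsHypothesis.ValiantsHypothesis.Theses.GrenetZeon
open Summit.ValiantsHypothesis.ValiantsHypothesis.Theorems.GrenetZeonGlynn

/-! ### The window stub is the crux -/

/-- **Crux ⟹ window stub.** `AbelianizationQP` implies the registered stub
`stub_subexpAbelianization` (with constant `c + 1 ≥ 1`): both `n^c + c` and `2^((log₂ m + c)^c)`
are monotone in `c` (`HasAlgDetRepr.mono`, `IsQPBounded.qexp_mono`), and the window hypothesis
`(log₂ m + c)^c < n` is simply dropped. [folklore] -/
theorem subexpAbelianization_of_abelianizationQP (h : AbelianizationQP) :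
    ∃ c : ℕ, 1 ≤ c ∧ ∀ n m : ℕ, 1 ≤ n → (Nat.log 2 m + c) ^ c < n →
      HasDetRepr (perPoly (Fin n) ℂ) m →
        HasAlgDetRepr (perPoly (Fin n) ℂ) (n ^ c + c) (2 ^ ((Nat.log 2 m + c) ^ c)) := by
  obtain ⟨c, hc⟩ := h
  refine ⟨c + 1, Nat.succ_pos c, fun n m hn _ hdet => ?_⟩
  have h1 : HasAlgDetRepr (perPoly (Fin n) ℂ) (n ^ c + c) (2 ^ ((Nat.log 2 m + c) ^ c)) :=
    hc n m hn hdet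
  exact h1.mono (Nat.add_le_add (Nat.pow_le_pow_right hn (Nat.le_succ c)) (Nat.le_succ c))
    (Nat.pow_le_pow_right Nat.two_pos (IsQPBounded.qexp_mono (Nat.log 2 m) (Nat.le_succ c)))

/-- **Window stub ⟹ crux** (the registered skeleton's composition, with the zeon point PROVED):
below the threshold `(log₂ m + c)^c < n` use the stub; above it pad the zeon point `(n, 2^n)`
(`zeonPoint_proof`; `n ≤ n^c + c` for `c ≥ 1`, `2^n ≤ 2^((log₂ m + c)^c)`). [cite: Glynn2010, Thm. 2.1] -/
theorem abelianizationQP_of_subexpAbelianization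
    (h : ∃ c : ℕ, 1 ≤ c ∧ ∀ n m : ℕ, 1 ≤ n → (Nat.log 2 m + c) ^ c < n →
      HasDetRepr (perPoly (Fin n) ℂ) m →
        HasAlgDetRepr (perPoly (Fin n) ℂ) (n ^ c + c) (2 ^ ((Nat.log 2 m + c) ^ c))) :
    AbelianizationQP := by
  obtain ⟨c, hc, h⟩ := h
  refine ⟨c, fun n m hn hdet => ?_⟩
  by_cases hw : (Nat.log 2 m + c) ^ c < n
  · exact h n m hn hw hdet
  · push Not at hw
    exact (show HasAlgDetRepr (perPoly (Fin n) ℂ) n (2 ^ n) from zeonPoint_proof n).mono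
      ((Nat.le_self_pow (by omega) n).trans (Nat.le_add_right _ _))
      (Nat.pow_le_pow_right (by norm_num) hw)

/-- **The window stub is equivalent to the crux** (given the proved zeon point): the line
`zeon-window` isolates no statement easier than `AbelianizationQP` itself. [folklore] -/
theorem abelianizationQP_iff_subexpAbelianization :
    AbelianizationQP ↔
      ∃ c : ℕ, 1 ≤ c ∧ ∀ n m : ℕ, 1 ≤ n → (Nat.log 2 m + c) ^ c < n →
        HasDetRepr (perPoly (Fin n) ℂ) m →
          HasAlgDetRepr (perPoly (Fin n) ℂ) (n ^ c + c) (2 ^ ((Nat.log 2 m + c) ^ c)) :=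
  ⟨subexpAbelianization_of_abelianizationQP, abelianizationQP_of_subexpAbelianization⟩

/-! ### Above an exponential lower bound the crux is automatic -/

/-- **Exponential lower bound ⟹ `AbelianizationQP`.** If for some `c` every affine determinantal
representation of `per_n` (`n ≥ 1`) of size `m` satisfies `n ≤ (log₂ m + c)^c` — an
exponential-type lower bound `dc(per_n) ≥ 2^{n^{1/c}}` — then the crux holds with constant
`max c 1`: nothing about the given representation is used, the zeon point `(n, 2^n)`
(`zeonPoint_proof`) padded by monotonicity (`n ≤ n^c' + c'`, `2^n ≤ 2^((log₂ m + c')^c')`) is the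
required representation. [cite: Glynn2010, Thm. 2.1] -/
theorem abelianizationQP_of_expLowerBound
    (h : ∃ c : ℕ, ∀ n m : ℕ, 1 ≤ n → HasDetRepr (perPoly (Fin n) ℂ) m → n ≤ (Nat.log 2 m + c) ^ c) :
    AbelianizationQP := by
  obtain ⟨c, hc⟩ := h
  refine ⟨max c 1, fun n m hn hdet => ?_⟩
  have hw : n ≤ (Nat.log 2 m + max c 1) ^ max c 1 :=
    (hc n m hn hdet).trans (IsQPBounded.qexp_mono (Nat.log 2 m) (le_max_left c 1))
  exact (show HasAlgDetRepr (perPoly (Fin n) ℂ) n (2 ^ n) from zeonPoint_proof n).mono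
    ((Nat.le_self_pow (by omega) n).trans (Nat.le_add_right _ _))
    (Nat.pow_le_pow_right (by norm_num) hw)

/-- The same with the hypothesis on determinantal complexity: if `n ≤ (log₂ dc(per_n) + c)^c` for
all `n ≥ 1`, then `AbelianizationQP` (a representation of size `m` has `dc(per_n) ≤ m`,
`determinantalComplexity_le_of_hasDetRepr`, and `log₂` is monotone). [cite: MignonRessayre2004, §1] -/
theorem abelianizationQP_of_expLowerBound_dc
    (h : ∃ c : ℕ, ∀ n : ℕ, 1 ≤ n →
      n ≤ (Nat.log 2 (determinantalComplexity (perPoly (Fin n) ℂ)) + c) ^ c) :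
    AbelianizationQP := by
  obtain ⟨c, hc⟩ := h
  refine abelianizationQP_of_expLowerBound ⟨c, fun n m hn hdet => (hc n hn).trans ?_⟩
  exact Nat.pow_le_pow_left
    (Nat.add_le_add_right (Nat.log_mono_right (determinantalComplexity_le_of_hasDetRepr hdet)) c) c

/-- **Exponential lower bound ⟹ the window stub** (`stub_subexpAbelianization`): the window
`(log₂ m + c)^c < n ≤ (log₂ m + c)^c` is then empty; formally, through the crux
(`abelianizationQP_of_expLowerBound`, `subexpAbelianization_of_abelianizationQP`).
[cite: Glynn2010, Thm. 2.1] -/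
theorem subexpAbelianization_of_expLowerBound
    (h : ∃ c : ℕ, ∀ n m : ℕ, 1 ≤ n → HasDetRepr (perPoly (Fin n) ℂ) m → n ≤ (Nat.log 2 m + c) ^ c) :
    ∃ c : ℕ, 1 ≤ c ∧ ∀ n m : ℕ, 1 ≤ n → (Nat.log 2 m + c) ^ c < n →
      HasDetRepr (perPoly (Fin n) ℂ) m →
        HasAlgDetRepr (perPoly (Fin n) ℂ) (n ^ c + c) (2 ^ ((Nat.log 2 m + c) ^ c)) :=
  subexpAbelianization_of_abelianizationQP (abelianizationQP_of_expLowerBound h)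

/-! ### Appendix (2026-08-31): normal forms of the crux — the content is the
superpolynomial-subexponential window, read at the single size `m = dc(per_n)` -/

/-- **The polynomial-regime corner is trivial.** An affine determinantal representation of
`per_n` of size `m ≤ n^c + c` is already an `(n^c + c, 2^((log₂ m + c)^c))`-representation: take
`R = ℂ`, `λ = id` (`HasDetRepr.hasAlgDetRepr`, an `(m, 1)`-representation) and pad both parameters
(`HasAlgDetRepr.mono`, `1 ≤ 2^e`).  No abelianization happens below polynomial size.
[cite: MignonRessayre2004, §1] -/
theorem hasAlgDetRepr_of_hasDetRepr_of_le {n m c : ℕ} (hdet : HasDetRepr (perPoly (Fin n) ℂ) m)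
    (hm : m ≤ n ^ c + c) :
    HasAlgDetRepr (perPoly (Fin n) ℂ) (n ^ c + c) (2 ^ ((Nat.log 2 m + c) ^ c)) :=
  hdet.hasAlgDetRepr.mono hm Nat.one_le_two_pow

/-- **Window normal form.** `AbelianizationQP` is equivalent to its restriction to the
SUPERPOLYNOMIAL-SUBEXPONENTIAL window `n^c + c < m`, `(log₂ m + c)^c < n`: below the window the
given representation itself serves (`hasAlgDetRepr_of_hasDetRepr_of_le`), above it the zeon point
(`zeonPoint_proof`, padded); inside it lies the whole content of the crux.  (Forward direction:
constant `c + 1`, hypotheses dropped.) [cite: Glynn2010, Thm. 2.1] -/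
theorem abelianizationQP_iff_window :
    AbelianizationQP ↔
      ∃ c : ℕ, 1 ≤ c ∧ ∀ n m : ℕ, 1 ≤ n → n ^ c + c < m → (Nat.log 2 m + c) ^ c < n →
        HasDetRepr (perPoly (Fin n) ℂ) m →
          HasAlgDetRepr (perPoly (Fin n) ℂ) (n ^ c + c) (2 ^ ((Nat.log 2 m + c) ^ c)) := by
  constructor
  · intro h
    obtain ⟨c, hc, h⟩ := subexpAbelianization_of_abelianizationQP h
    exact ⟨c, hc, fun n m hn _ hw hdet => h n m hn hw hdet⟩
  · rintro ⟨c, hc, h⟩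
    refine ⟨c, fun n m hn hdet => ?_⟩
    by_cases hm : m ≤ n ^ c + c
    · exact hasAlgDetRepr_of_hasDetRepr_of_le hdet hm
    by_cases hw : (Nat.log 2 m + c) ^ c < n
    · exact h n m hn (not_le.mp hm) hw hdet
    · push Not at hw
      exact (show HasAlgDetRepr (perPoly (Fin n) ℂ) n (2 ^ n) from zeonPoint_proof n).mono
        ((Nat.le_self_pow (by omega) n).trans (Nat.le_add_right _ _))
        (Nat.pow_le_pow_right (by norm_num) hw)

/-- **Single-size normal form.** Since affine determinantal representations of `per_n` exist
exactly in the sizes `m ≥ dc(per_n)` (`hasDetRepr_determinantalComplexity_holds`,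
`determinantalComplexity_le_of_hasDetRepr`) and the conclusion only weakens as `m` grows
(`log₂` monotone, `HasAlgDetRepr.mono`), the crux is a statement about ONE number per `n`:
`AbelianizationQP ↔ ∃ c, ∀ n ≥ 1, per_n has an (n^c + c, 2^((log₂ dc(per_n) + c)^c))-representation`
— polynomial matrix size at a coefficient dimension quasi-polynomial in `dc(per_n)`.
[cite: MignonRessayre2004, §1] -/
theorem abelianizationQP_iff_dc :
    AbelianizationQP ↔
      ∃ c : ℕ, ∀ n : ℕ, 1 ≤ n →
        HasAlgDetRepr (perPoly (Fin n) ℂ) (n ^ c + c)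
          (2 ^ ((Nat.log 2 (determinantalComplexity (perPoly (Fin n) ℂ)) + c) ^ c)) := by
  constructor
  · rintro ⟨c, h⟩
    exact ⟨c, fun n hn => h n _ hn (hasDetRepr_determinantalComplexity_holds (perPoly (Fin n) ℂ))⟩
  · rintro ⟨c, h⟩
    refine ⟨c, fun n m hn hdet => (h n hn).mono le_rfl (Nat.pow_le_pow_right Nat.two_pos ?_)⟩
    exact Nat.pow_le_pow_left
      (Nat.add_le_add_right (Nat.log_mono_right (determinantalComplexity_le_of_hasDetRepr hdet)) c) c

/-- **The crux at one level `n`, as a monotone threshold in `dc(per_n)`.** For fixed `c` and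
`n ≥ 1`, the level-`n` instance of the single-size normal form holds as soon as
`n ≤ (log₂ dc(per_n) + c)^c` (exponential regime: zeon point), and — at the other end — as soon as
`dc(per_n) ≤ n^c + c` (polynomial regime: the representation itself); only
`n^c + c < dc(per_n) < 2^{n^{1/c}}`-type growth is undecided. [cite: Glynn2010, Thm. 2.1] -/
theorem hasAlgDetRepr_dc_of_not_window {n c : ℕ} (hc : 1 ≤ c)
    (h : determinantalComplexity (perPoly (Fin n) ℂ) ≤ n ^ c + c ∨
      n ≤ (Nat.log 2 (determinantalComplexity (perPoly (Fin n) ℂ)) + c) ^ c) :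
    HasAlgDetRepr (perPoly (Fin n) ℂ) (n ^ c + c)
      (2 ^ ((Nat.log 2 (determinantalComplexity (perPoly (Fin n) ℂ)) + c) ^ c)) := by
  rcases h with hm | hw
  · exact hasAlgDetRepr_of_hasDetRepr_of_le
      (hasDetRepr_determinantalComplexity_holds (perPoly (Fin n) ℂ)) hm
  · exact (show HasAlgDetRepr (perPoly (Fin n) ℂ) n (2 ^ n) from zeonPoint_proof n).mono
      ((Nat.le_self_pow (by omega) n).trans (Nat.le_add_right _ _))
      (Nat.pow_le_pow_right (by norm_num) hw)

/-! ### Appendix B (2026-08-31): "for all `n ≥ 1`" = "for all large `n`" — small levels are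
absorbed into the constant by the zeon point -/

/-- **Eventual normal form.** `AbelianizationQP` (stated for every `n ≥ 1`) is equivalent to its
"for all large `n`" form: the finitely many levels `n < n₀` are served by the zeon point with the
constant raised to `c' = max c n₀` (`n ≤ c' ≤ (log₂ m + c')^c'`, `IsQPBounded.le_qexp`; `n ≤ n^c' + c'`).
[cite: Glynn2010, Thm. 2.1] -/
theorem abelianizationQP_iff_eventually :
    AbelianizationQP ↔
      ∃ c n₀ : ℕ, ∀ n ≥ n₀, ∀ m : ℕ, HasDetRepr (perPoly (Fin n) ℂ) m →
        HasAlgDetRepr (perPoly (Fin n) ℂ) (n ^ c + c) (2 ^ ((Nat.log 2 m + c) ^ c)) := by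
  constructor
  · rintro ⟨c, h⟩
    exact ⟨c, 1, fun n hn m hdet => h n m hn hdet⟩
  · rintro ⟨c, n₀, h⟩
    refine ⟨max c n₀, fun n m hn hdet => ?_⟩
    by_cases hn₀ : n₀ ≤ n
    · exact (h n hn₀ m hdet).mono
        (Nat.add_le_add (Nat.pow_le_pow_right hn (le_max_left c n₀)) (le_max_left c n₀))
        (Nat.pow_le_pow_right Nat.two_pos (IsQPBounded.qexp_mono (Nat.log 2 m) (le_max_left c n₀)))
    · push Not at hn₀
      have hw : n ≤ (Nat.log 2 m + max c n₀) ^ max c n₀ :=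
        (hn₀.le.trans (le_max_right c n₀)).trans (IsQPBounded.le_qexp (Nat.log 2 m) (max c n₀))
      exact (show HasAlgDetRepr (perPoly (Fin n) ℂ) n (2 ^ n) from zeonPoint_proof n).mono
        ((Nat.le_self_pow (by omega) n).trans (Nat.le_add_right _ _))
        (Nat.pow_le_pow_right (by norm_num) hw)

/-- **Exponential-type lower bound for all large `n` ⟹ the crux.** If `n ≤ (log₂ dc(per_n) + c)^c`
for all `n ≥ n₀` (growth `dc(per_n) ≥ 2^{n^{1/c}}`-type, eventually), then `AbelianizationQP`: at
those levels every representation has size `m ≥ dc(per_n)`, so the zeon point padded to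
`(n^c + c, 2^((log₂ m + c)^c))` serves (`hasAlgDetRepr_dc_of_not_window`-style), and the eventual
normal form absorbs `n < n₀`. [cite: Glynn2010, Thm. 2.1] -/
theorem abelianizationQP_of_expLowerBound_eventually
    (h : ∃ c n₀ : ℕ, ∀ n ≥ n₀,
      n ≤ (Nat.log 2 (determinantalComplexity (perPoly (Fin n) ℂ)) + c) ^ c) :
    AbelianizationQP := by
  obtain ⟨c, n₀, hc⟩ := h
  refine abelianizationQP_iff_eventually.mpr ⟨max c 1, n₀, fun n hn m hdet => ?_⟩
  have hw : n ≤ (Nat.log 2 m + max c 1) ^ max c 1 :=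
    calc n ≤ (Nat.log 2 (determinantalComplexity (perPoly (Fin n) ℂ)) + c) ^ c := hc n hn
      _ ≤ (Nat.log 2 m + c) ^ c := Nat.pow_le_pow_left (Nat.add_le_add_right
          (Nat.log_mono_right (determinantalComplexity_le_of_hasDetRepr hdet)) c) c
      _ ≤ (Nat.log 2 m + max c 1) ^ max c 1 := IsQPBounded.qexp_mono (Nat.log 2 m) (le_max_left c 1)
  exact (show HasAlgDetRepr (perPoly (Fin n) ℂ) n (2 ^ n) from zeonPoint_proof n).mono
    ((Nat.le_self_pow (by omega) n).trans (Nat.le_add_right _ _))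
    (Nat.pow_le_pow_right (by norm_num) hw)

end Summit.ValiantsHypothesis.ValiantsHypothesis.Theorems.GrenetZeonAbelianizationQP

end
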